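import Mathlib
import HarnessLib
import Summits.Ventures.LatticeQCDFlow.Scoring.SampleMeanConvexOrder
import Summits.Ventures.LatticeQCDFlow.Scoring.GaussianStudentScaleMixture
import Summits.Ventures.LatticeQCDFlow.Scoring.GaussianStudentEventReduction
import Summits.Ventures.LatticeQCDFlow.Exactness.NCMCGeneralSpaceReplicaTStatisticStudent

/-!
# THE STUDENT-TYPE CALIBRATION IS STRICTLY INCREASING IN THE NUMBER OF BATCHES / REPLICAS:
# `P(|t_n| ≤ q) < P(|t_{n+1}| ≤ q)` for every `q > 0`, i.e. `L_R(q) < L_{R+1}(q)`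

HONEST FRAMING: exact (Metropolis-corrected) sampling algorithms for lattice gauge theory;
figures of merit are autocorrelation/cost numbers at stated couplings and volumes; no
continuum-physics claim.

Venture `LatticeQCDFlow` (cell pub-lqcd), topic `Scoring`; FANOUT row 4 (`s0-u1-b`, GEN-33).
NEW WORK of the cell (classical; not in Mathlib), no definition, nothing cited as a fact (the
monotonicity of Student's `t_ν` quantiles in `ν` is NAMED ONLY; Mathlib has no Student law).

WHY (row 4).  Error bars built from a FIXED number `R` of batches, replicas or independent runs and
read with a quantile `q` have ONE universal limiting coverage, the Student-ratio probability
`L_R(q) = N(0,1)^{⊗R}{|t| ≤ q} = N(0,1)^{⊗R}{z | |z₀| ≤ q √((Σ_{r≠0} z_r²)/(R−1))}` (row 13 GEN-23/24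
K3/S/J…; row 4 GEN-32's fixed-batch-count / fixed-replica-count / two-arm files print the same
functional as `{a ḡ² ≤ q² s²(g)}`).  Known in the tree: `L_2(q) = (2/π) arctan q`,
`L_R(q) ≤ N(0,1)([−q, q])`, `L_R(q) → N(0,1)([−q, q])` as `R → ∞`; listed NOT CLAIMED by both rows:
the dependence on `R`.  This file settles it: **for every `q > 0`, `L_R(q)` is STRICTLY INCREASING
in `R`** — each additional batch/replica, read with the same quantile, strictly raises the
asymptotic coverage (equivalently: the calibrating Student-type quantile strictly decreases in
`R`), and the approach to the nominal level is monotone from below.  Proof: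
`L_{n+1}(q) = E ψ_q(V_n)` with `V_n` the mean of `n` i.i.d. squared standard normals and
`ψ_q(x) = N(0,1)([−q√x, q√x])` strictly concave on `[0, ∞)` (`Scoring/GaussianStudentScaleMixture`);
sample means of i.i.d. variables strictly decrease in convex order
(`Scoring/SampleMeanConvexOrder`); the translation to the replica-`t` event is row 13's BUILT
`pi_gaussianReal_measure_abs_tStat_le_eq_studentRatio` (imported, not restated), and to row 4's
GEN-32 event forms the exact identities of `Scoring/GaussianStudentEventReduction`.

## Content

* **`pi_gaussianReal_studentRatio_lt_succ`** (§1) — `q > 0`, `n ≥ 1`: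
  `N(0,1)^{⊗(n+1)}{|z₀| ≤ q√((Σ_{j=1}^{n} z_j²)/n)} < N(0,1)^{⊗(n+2)}{|z₀| ≤ q√((Σ_{j=1}^{n+1} z_j²)/(n+1))}`;
  `pi_gaussianReal_studentRatio_le_succ` (`q ≥ 0`); `strictMono_pi_gaussianReal_studentRatio`,
  `monotone_pi_gaussianReal_studentRatio`.
* `setOf_studentRatio_erase_eq` (§2) — the split form equals row 13's `univ.erase`/`Fintype.card`
  form.
* **`replicaT_coverage_lt_succ`** (§2) — `q > 0`: `L_{n+2}(q) < L_{n+3}(q)` in the replica-`t` form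
  over `Fin (n + 2)` (verbatim the event of row 13's `tendsto_replicaT_coverage_atTop_fin`);
  `replicaT_coverage_le_succ` (`q ≥ 0`); **`strictMono_replicaT_coverage`**,
  `monotone_replicaT_coverage`.

* **`pi_gaussianReal_student_lt_succ`**, **`pi_gaussianReal_twoSample_student_lt_succ`** (§3) — the
  same strict increase in row 4's own event forms (GEN-32's one-run `{a ḡ² ≤ t² s²(g)}` and two-arm
  `{a(ḡ − h̄)² ≤ t²(s²(g) + s²(h))}` events, `a = n + 1 ≥ 2 ↦ a + 1`), through the exact identities
  of `Scoring/GaussianStudentEventReduction`; `pi_gaussianReal_studentRatio_lt_of_lt` (`m₁ < m₂`),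
  `pi_gaussianReal_studentRatio_le_of_le` (`m₁ ≤ m₂`, `q ≥ 0`).

NOT CLAIMED: the size of the increments (a rate in `R`); anything numerical.
-/

open MeasureTheory ProbabilityTheory Filter Topology Finset

namespace Summit.Ventures.LatticeQCDFlow.Scoring

open Set

/-! ## §1 THE STUDENT-RATIO PROBABILITY IS STRICTLY INCREASING IN THE NUMBER OF COORDINATES -/

section Monotone

/-- **ONE MORE COORDINATE STRICTLY INCREASES THE STUDENT-RATIO PROBABILITY** (`q > 0`, `n ≥ 1`):
`N(0,1)^{⊗(n+1)}{|z₀| ≤ q √((Σ_{j=1}^{n} z_j²)/n)} < N(0,1)^{⊗(n+2)}{|z₀| ≤ q √((Σ_{j=1}^{n+1} z_j²)/(n+1))}`,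
i.e. `P(|t_n| ≤ q) < P(|t_{n+1}| ≤ q)` in textbook notation. [ours] -/
theorem pi_gaussianReal_studentRatio_lt_succ {q : ℝ} (hq : 0 < q) {n : ℕ} (hn : 1 ≤ n) :
    (Measure.pi fun _ : Fin (n + 1) => gaussianReal 0 1)
        {z : Fin (n + 1) → ℝ | |z 0| ≤ q * Real.sqrt ((∑ j : Fin n, z j.succ ^ 2) / (n : ℝ))}
      < (Measure.pi fun _ : Fin (n + 1 + 1) => gaussianReal 0 1)
        {z : Fin (n + 1 + 1) → ℝ | |z 0| ≤ q *
          Real.sqrt ((∑ j : Fin (n + 1), z j.succ ^ 2) / ((n + 1 : ℕ) : ℝ))} := by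
  rw [← ENNReal.toReal_lt_toReal (measure_ne_top _ _) (measure_ne_top _ _),
    pi_gaussianReal_studentRatio_real_eq_integral q n,
    pi_gaussianReal_studentRatio_real_eq_integral q (n + 1)]
  exact pi_integral_strictConcave_mean_strictMono (μ := gaussianReal 0 1) (convex_Ici 0)
    (strictConcaveOn_gaussianReal_real_Icc_sqrt hq) (continuous_gaussianReal_real_Icc_sqrt hq.le)
    ⟨1, abs_gaussianReal_real_Icc_sqrt_le_one q⟩ (measurable_id.pow_const 2)
    (fun x => sq_nonneg x) gaussianReal_sq_nondegenerate hn

/-- Weak form for `q ≥ 0`: one more coordinate never decreases the Student-ratio probability. [ours] -/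
theorem pi_gaussianReal_studentRatio_le_succ {q : ℝ} (hq : 0 ≤ q) {n : ℕ} (hn : 1 ≤ n) :
    (Measure.pi fun _ : Fin (n + 1) => gaussianReal 0 1)
        {z : Fin (n + 1) → ℝ | |z 0| ≤ q * Real.sqrt ((∑ j : Fin n, z j.succ ^ 2) / (n : ℝ))}
      ≤ (Measure.pi fun _ : Fin (n + 1 + 1) => gaussianReal 0 1)
        {z : Fin (n + 1 + 1) → ℝ | |z 0| ≤ q *
          Real.sqrt ((∑ j : Fin (n + 1), z j.succ ^ 2) / ((n + 1 : ℕ) : ℝ))} := by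
  rw [← ENNReal.toReal_le_toReal (measure_ne_top _ _) (measure_ne_top _ _),
    pi_gaussianReal_studentRatio_real_eq_integral q n,
    pi_gaussianReal_studentRatio_real_eq_integral q (n + 1)]
  exact pi_integral_concave_mean_mono (μ := gaussianReal 0 1) (convex_Ici 0)
    (concaveOn_gaussianReal_real_Icc_sqrt hq) (continuous_gaussianReal_real_Icc_sqrt hq)
    ⟨1, abs_gaussianReal_real_Icc_sqrt_le_one q⟩ (measurable_id.pow_const 2)
    (fun x => sq_nonneg x) hn

/-- **The Student-ratio probability is STRICTLY INCREASING in the number of coordinates** (`q > 0`):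
`n ↦ N(0,1)^{⊗(n+2)}{|z₀| ≤ q √((Σ_{j=1}^{n+1} z_j²)/(n+1))}` is strictly monotone. [ours] -/
theorem strictMono_pi_gaussianReal_studentRatio {q : ℝ} (hq : 0 < q) :
    StrictMono fun n : ℕ => (Measure.pi fun _ : Fin (n + 1 + 1) => gaussianReal 0 1)
        {z : Fin (n + 1 + 1) → ℝ | |z 0| ≤ q *
          Real.sqrt ((∑ j : Fin (n + 1), z j.succ ^ 2) / ((n + 1 : ℕ) : ℝ))} :=
  strictMono_nat_of_lt_succ fun n => pi_gaussianReal_studentRatio_lt_succ hq (by omega)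

/-- Weak form (`q ≥ 0`): monotone in the number of coordinates. [ours] -/
theorem monotone_pi_gaussianReal_studentRatio {q : ℝ} (hq : 0 ≤ q) :
    Monotone fun n : ℕ => (Measure.pi fun _ : Fin (n + 1 + 1) => gaussianReal 0 1)
        {z : Fin (n + 1 + 1) → ℝ | |z 0| ≤ q *
          Real.sqrt ((∑ j : Fin (n + 1), z j.succ ^ 2) / ((n + 1 : ℕ) : ℝ))} :=
  monotone_nat_of_le_succ fun n => pi_gaussianReal_studentRatio_le_succ hq (by omega)

end Monotone

/-! ## §2 In the tree's replica-`t` vocabulary: `L_R(q) < L_{R+1}(q)` -/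

section ReplicaT

/-- The split form of the Student-ratio event equals row 13's `univ.erase` / `Fintype.card` form. -/
theorem setOf_studentRatio_erase_eq (q : ℝ) (n : ℕ) :
    {z : Fin (n + 1) → ℝ | |z 0| ≤ q * Real.sqrt ((∑ r ∈ univ.erase 0, z r ^ 2)
        / ((Fintype.card (Fin (n + 1)) : ℝ) - 1))}
      = {z : Fin (n + 1) → ℝ | |z 0| ≤ q * Real.sqrt ((∑ j : Fin n, z j.succ ^ 2) / (n : ℝ))} := by
  ext z
  have h1 : ∑ r ∈ univ.erase 0, z r ^ 2 = ∑ j : Fin n, z j.succ ^ 2 := by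
    rw [Finset.sum_erase_eq_sub (Finset.mem_univ _), Fin.sum_univ_succ]
    ring
  have h2 : ((Fintype.card (Fin (n + 1)) : ℝ) - 1) = (n : ℝ) := by
    rw [Fintype.card_fin]; push_cast; ring
  simp only [Set.mem_setOf_eq, h1, h2]

/-- **`L_R(q) < L_{R+1}(q)` FOR EVERY `R ≥ 2` AND `q > 0`** — the universal limiting coverage of the
replica-`t` / jackknife / independent-runs bar with `R = n + 2` replicas (row 13 GEN-23/24:
`N(0,1)^{⊗R}{|t| ≤ q}`, `t = z̄/√(Σ(z_r − z̄)²/(R(R−1)))`), equivalently of row 4's fixed-count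
batch-means / replica bars, is STRICTLY INCREASING in the number of replicas: one more replica (or
batch) read with the same quantile `q` always covers more, and (with row 13's `…ManyReplicas` /
row 4's `GaussianStudentLimit`) the coverages increase TO the nominal `N(0,1)([−q, q])`. [ours] -/
theorem replicaT_coverage_lt_succ {q : ℝ} (hq : 0 < q) (n : ℕ) :
    (Measure.pi fun _ : Fin (n + 2) => gaussianReal 0 1)
        {z : Fin (n + 2) → ℝ | |(∑ r, z r) / Fintype.card (Fin (n + 2))
          / Real.sqrt ((∑ r, (z r - (∑ r', z r') / Fintype.card (Fin (n + 2))) ^ 2)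
            / ((Fintype.card (Fin (n + 2)) : ℝ) * (Fintype.card (Fin (n + 2)) - 1)))| ≤ q}
      < (Measure.pi fun _ : Fin (n + 3) => gaussianReal 0 1)
        {z : Fin (n + 3) → ℝ | |(∑ r, z r) / Fintype.card (Fin (n + 3))
          / Real.sqrt ((∑ r, (z r - (∑ r', z r') / Fintype.card (Fin (n + 3))) ^ 2)
            / ((Fintype.card (Fin (n + 3)) : ℝ) * (Fintype.card (Fin (n + 3)) - 1)))| ≤ q} := by
  rw [Exactness.GeneralNCMC.pi_gaussianReal_measure_abs_tStat_le_eq_studentRatio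
      (0 : Fin (n + 2)) one_ne_zero q,
    Exactness.GeneralNCMC.pi_gaussianReal_measure_abs_tStat_le_eq_studentRatio
      (0 : Fin (n + 3)) one_ne_zero q]
  have h := pi_gaussianReal_studentRatio_lt_succ hq (n := n + 1) (by omega)
  rw [← setOf_studentRatio_erase_eq q (n + 1), ← setOf_studentRatio_erase_eq q (n + 2)] at h
  exact h

/-- Weak form for `q ≥ 0`: `L_R(q) ≤ L_{R+1}(q)`. [ours] -/
theorem replicaT_coverage_le_succ {q : ℝ} (hq : 0 ≤ q) (n : ℕ) :
    (Measure.pi fun _ : Fin (n + 2) => gaussianReal 0 1)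
        {z : Fin (n + 2) → ℝ | |(∑ r, z r) / Fintype.card (Fin (n + 2))
          / Real.sqrt ((∑ r, (z r - (∑ r', z r') / Fintype.card (Fin (n + 2))) ^ 2)
            / ((Fintype.card (Fin (n + 2)) : ℝ) * (Fintype.card (Fin (n + 2)) - 1)))| ≤ q}
      ≤ (Measure.pi fun _ : Fin (n + 3) => gaussianReal 0 1)
        {z : Fin (n + 3) → ℝ | |(∑ r, z r) / Fintype.card (Fin (n + 3))
          / Real.sqrt ((∑ r, (z r - (∑ r', z r') / Fintype.card (Fin (n + 3))) ^ 2)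
            / ((Fintype.card (Fin (n + 3)) : ℝ) * (Fintype.card (Fin (n + 3)) - 1)))| ≤ q} := by
  rw [Exactness.GeneralNCMC.pi_gaussianReal_measure_abs_tStat_le_eq_studentRatio
      (0 : Fin (n + 2)) one_ne_zero q,
    Exactness.GeneralNCMC.pi_gaussianReal_measure_abs_tStat_le_eq_studentRatio
      (0 : Fin (n + 3)) one_ne_zero q]
  have h := pi_gaussianReal_studentRatio_le_succ hq (n := n + 1) (by omega)
  rw [← setOf_studentRatio_erase_eq q (n + 1), ← setOf_studentRatio_erase_eq q (n + 2)] at h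
  exact h

/-- **`R ↦ L_R(q)` is strictly increasing** (`q > 0`; `R = n + 2`, replicas indexed by `Fin R`). [ours] -/
theorem strictMono_replicaT_coverage {q : ℝ} (hq : 0 < q) :
    StrictMono fun n : ℕ => (Measure.pi fun _ : Fin (n + 2) => gaussianReal 0 1)
        {z : Fin (n + 2) → ℝ | |(∑ r, z r) / Fintype.card (Fin (n + 2))
          / Real.sqrt ((∑ r, (z r - (∑ r', z r') / Fintype.card (Fin (n + 2))) ^ 2)
            / ((Fintype.card (Fin (n + 2)) : ℝ) * (Fintype.card (Fin (n + 2)) - 1)))| ≤ q} :=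
  strictMono_nat_of_lt_succ fun n => replicaT_coverage_lt_succ hq n

/-- `R ↦ L_R(q)` is monotone (`q ≥ 0`). [ours] -/
theorem monotone_replicaT_coverage {q : ℝ} (hq : 0 ≤ q) :
    Monotone fun n : ℕ => (Measure.pi fun _ : Fin (n + 2) => gaussianReal 0 1)
        {z : Fin (n + 2) → ℝ | |(∑ r, z r) / Fintype.card (Fin (n + 2))
          / Real.sqrt ((∑ r, (z r - (∑ r', z r') / Fintype.card (Fin (n + 2))) ^ 2)
            / ((Fintype.card (Fin (n + 2)) : ℝ) * (Fintype.card (Fin (n + 2)) - 1)))| ≤ q} :=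
  monotone_nat_of_le_succ fun n => replicaT_coverage_le_succ hq n

end ReplicaT

/-! ## §3 Row 4's own forms (GEN-32's fixed-count events), via `Scoring/GaussianStudentEventReduction` -/

section RowFourForms

/-- The split Student-ratio probability is strictly increasing along `m₁ < m₂` (`q > 0`, `m₁ ≥ 1`). [ours] -/
theorem pi_gaussianReal_studentRatio_lt_of_lt {q : ℝ} (hq : 0 < q) {m₁ m₂ : ℕ} (hm₁ : 1 ≤ m₁)
    (h : m₁ < m₂) :
    (Measure.pi fun _ : Fin (m₁ + 1) => gaussianReal 0 1)
        {z : Fin (m₁ + 1) → ℝ | |z 0| ≤ q * Real.sqrt ((∑ j : Fin m₁, z j.succ ^ 2) / (m₁ : ℝ))}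
      < (Measure.pi fun _ : Fin (m₂ + 1) => gaussianReal 0 1)
        {z : Fin (m₂ + 1) → ℝ | |z 0| ≤ q * Real.sqrt ((∑ j : Fin m₂, z j.succ ^ 2) / (m₂ : ℝ))} := by
  induction m₂, h using Nat.le_induction with
  | base => exact pi_gaussianReal_studentRatio_lt_succ hq hm₁
  | succ k hk ih => exact ih.trans (pi_gaussianReal_studentRatio_lt_succ hq (by omega))

/-- The split Student-ratio probability is monotone along `m₁ ≤ m₂` (`q ≥ 0`, `m₁ ≥ 1`). [ours] -/
theorem pi_gaussianReal_studentRatio_le_of_le {q : ℝ} (hq : 0 ≤ q) {m₁ m₂ : ℕ} (hm₁ : 1 ≤ m₁)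
    (h : m₁ ≤ m₂) :
    (Measure.pi fun _ : Fin (m₁ + 1) => gaussianReal 0 1)
        {z : Fin (m₁ + 1) → ℝ | |z 0| ≤ q * Real.sqrt ((∑ j : Fin m₁, z j.succ ^ 2) / (m₁ : ℝ))}
      ≤ (Measure.pi fun _ : Fin (m₂ + 1) => gaussianReal 0 1)
        {z : Fin (m₂ + 1) → ℝ | |z 0| ≤ q * Real.sqrt ((∑ j : Fin m₂, z j.succ ^ 2) / (m₂ : ℝ))} := by
  induction m₂, h using Nat.le_induction with
  | base => exact le_rfl
  | succ k hk ih => exact ih.trans (pi_gaussianReal_studentRatio_le_succ hq (by omega))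

/-- **Row 4's one-run fixed-count calibration is STRICTLY INCREASING in the number of batches**
(`t > 0`, `a = n + 1 ≥ 2`): in GEN-32's verbatim event form,
`N(0,1)^{⊗a}{a ḡ² ≤ t² s²(g)} < N(0,1)^{⊗(a+1)}{(a+1) ḡ² ≤ t² s²(g)}`. [ours] -/
theorem pi_gaussianReal_student_lt_succ {t : ℝ} (ht : 0 < t) {n : ℕ} (hn : 1 ≤ n) :
    (Measure.pi fun _ : Fin (n + 1) => gaussianReal 0 1)
        {g : Fin (n + 1) → ℝ | ((n + 1 : ℕ) : ℝ) * ((∑ i, g i) / ((n + 1 : ℕ) : ℝ)) ^ 2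
          ≤ t ^ 2 * ((∑ j, (g j - (∑ i, g i) / ((n + 1 : ℕ) : ℝ)) ^ 2) / (((n + 1 : ℕ) : ℝ) - 1))}
      < (Measure.pi fun _ : Fin (n + 1 + 1) => gaussianReal 0 1)
        {g : Fin (n + 1 + 1) → ℝ | ((n + 1 + 1 : ℕ) : ℝ) * ((∑ i, g i) / ((n + 1 + 1 : ℕ) : ℝ)) ^ 2
          ≤ t ^ 2 * ((∑ j, (g j - (∑ i, g i) / ((n + 1 + 1 : ℕ) : ℝ)) ^ 2)
            / (((n + 1 + 1 : ℕ) : ℝ) - 1))} := by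
  rw [pi_gaussianReal_student_eq_studentRatio ht.le n, pi_gaussianReal_student_eq_studentRatio ht.le (n + 1)]
  exact pi_gaussianReal_studentRatio_lt_succ ht hn

/-- **Row 4's two-arm (A-vs-B) fixed-count calibration is STRICTLY INCREASING in the number of
batches per arm** (`t > 0`, `a = n + 1 ≥ 2`): in GEN-32's verbatim event form,
`(N^{⊗a} ⊗ N^{⊗a}){a(ḡ − h̄)² ≤ t²(s²(g) + s²(h))} < (N^{⊗(a+1)} ⊗ N^{⊗(a+1)}){…}` — two more
squares in the Student ratio (`2a − 2 ↦ 2a`). [ours] -/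
theorem pi_gaussianReal_twoSample_student_lt_succ {t : ℝ} (ht : 0 < t) {n : ℕ} (hn : 1 ≤ n) :
    ((Measure.pi fun _ : Fin (n + 1) => gaussianReal 0 1).prod
        (Measure.pi fun _ : Fin (n + 1) => gaussianReal 0 1))
      {p : (Fin (n + 1) → ℝ) × (Fin (n + 1) → ℝ) |
        ((n + 1 : ℕ) : ℝ) * ((∑ i, p.1 i) / ((n + 1 : ℕ) : ℝ) - (∑ i, p.2 i) / ((n + 1 : ℕ) : ℝ)) ^ 2
          ≤ t ^ 2 * (((∑ j, (p.1 j - (∑ i, p.1 i) / ((n + 1 : ℕ) : ℝ)) ^ 2) / (((n + 1 : ℕ) : ℝ) - 1))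
            + ((∑ j, (p.2 j - (∑ i, p.2 i) / ((n + 1 : ℕ) : ℝ)) ^ 2) / (((n + 1 : ℕ) : ℝ) - 1)))}
      < ((Measure.pi fun _ : Fin (n + 1 + 1) => gaussianReal 0 1).prod
        (Measure.pi fun _ : Fin (n + 1 + 1) => gaussianReal 0 1))
      {p : (Fin (n + 1 + 1) → ℝ) × (Fin (n + 1 + 1) → ℝ) |
        ((n + 1 + 1 : ℕ) : ℝ) * ((∑ i, p.1 i) / ((n + 1 + 1 : ℕ) : ℝ)
            - (∑ i, p.2 i) / ((n + 1 + 1 : ℕ) : ℝ)) ^ 2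
          ≤ t ^ 2 * (((∑ j, (p.1 j - (∑ i, p.1 i) / ((n + 1 + 1 : ℕ) : ℝ)) ^ 2)
              / (((n + 1 + 1 : ℕ) : ℝ) - 1))
            + ((∑ j, (p.2 j - (∑ i, p.2 i) / ((n + 1 + 1 : ℕ) : ℝ)) ^ 2)
              / (((n + 1 + 1 : ℕ) : ℝ) - 1)))} := by
  rw [pi_gaussianReal_twoSample_student_eq_studentRatio ht.le hn,
    pi_gaussianReal_twoSample_student_eq_studentRatio ht.le (by omega : 1 ≤ n + 1)]
  exact pi_gaussianReal_studentRatio_lt_of_lt ht (m₁ := n + n) (by omega) (by omega)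

end RowFourForms

end Summit.Ventures.LatticeQCDFlow.Scoring
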